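import Summits.HodgeConjecture.HodgeConjecture.Theorems.F0P3cStCharTSRootPersist   -- ★ P1∕P2 «a simple root persists», over ★ `F0P3cStCharTSRootCalculus`
import HarnessLib

/-!
# F0 · P3c · line LH6 «StCharTS» — «ROOT-COUNT-LC★»: near a monic polynomial with SIMPLE rational roots, the rational roots of nearby
# monic polynomials correspond ONE-TO-ONE to the old ones inside a fixed window (proper normed field); the number of rational roots —
# and of rational roots with any window-stable property — is locally constant

Cell `pub/hodgecm-mathlib`, crux H413 = `stmt-HodgeConjecture-24833` (lane `--supports … --as helper`), route HCCMUnconditional; seat LH4-p03 (g7).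
THEOREMS ONLY over ★ `Summits…Theorems.F0P3cStCharTSRootPersist` (hence ★ `…RootCalculus`, Mathlib); no definition ∕ instance ∕ notation ∕ named fact ∕ `sorry`.
Consumer (datum road MAP-DATUM-ROAD v4, slice S13b «UPR-LC» road (I)(b)+(e), F0P3-p02 (g20)): «the number of norm-one roots of `charpoly y` — i.e. of matched
`H`-classes — is locally constant in `y` near a `G`-regular `x₀`» = `card_filter_roots_eq_of_near` below with `P := fun u => σ u * u = 1`, once the norm-one
clause is shown window-stable (LH4-p01 (g5)'s (ii), not here).

THE MATHEMATICS (`K` a PROPER normed field, so complete and locally compact; `p₀` monic with every `K`-root SIMPLE, `p₀′(a) ≠ 0`).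
* §1 `card_filter_eq_of_correspondence`: pure combinatorics — two finsets in a window-correspondence which is unique both ways have the same number
  of elements satisfying any pair of predicates that agree across the correspondence (Mathlib `Finset.card_bij`); `exists_pos_le_of_finset` (a positive
  lower bound for finitely many positive reals).
* §2 `exists_window_roots_correspondence`: there are a window `δ > 0` separating the roots of `p₀` (`a ≠ b ⇒ 2δ ≤ ‖a − b‖`) and `ρ > 0` such that for every
  monic `p` of the same degree with coefficients within `ρ`: every `K`-root of `p` lies within `δ` of EXACTLY ONE root of `p₀` (★ `exists_forall_root_near` + separation),
  and every root of `p₀` has EXACTLY ONE `K`-root of `p` within `δ` (★ P1 `exists_root_near_of_simple_root` + ★ `exists_root_unique_near`).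
* §3 `card_roots_toFinset_eq_of_near` ∕ `card_filter_roots_eq_of_near`: hence `#(p.roots.toFinset) = #(p₀.roots.toFinset)`, and the same for the roots
  satisfying a predicate `P` with `‖r − a‖ < δ → (P r ↔ P a)` across the window; `Separable` dresses via ★ `isUnit_aeval_derivative_of_separable`.
HONEST LABEL: HC_CM is proved only modulo the 7 printed citations (2 remaining named inputs: hLiu418 = `stmt-HodgeConjecture-24832`, h413 =
`stmt-HodgeConjecture-24833`) until rung 0 closes; this file closes no organ (count-neutral datum-road brick).

## References
* [Gouvea1993PadicNumbers] F. Q. Gouvêa, *p-adic Numbers*, Universitext (1993∕1997), §6.8 (continuity of roots).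
* [Borel1991] A. Borel, *Linear Algebraic Groups*, 2nd ed. (1991), IV.12.2–12.3 (regular semisimple elements).
* [Rogawski1990] J. D. Rogawski, *Automorphic Representations of Unitary Groups in Three Variables*, Ann. of Math. Stud. 123 (1990), §12.5 pp. 182–184.
-/

set_option autoImplicit false
-- the mandated namespace has the single-problem summit's repeated segment (`HodgeConjecture.HodgeConjecture`)
set_option linter.dupNamespace false

noncomputable section

open Polynomial Filter Topology Metric Set
open Summit.HodgeConjecture.HodgeConjecture.Cruxes.H413.F0P3cStCharTSRootCalculus (exists_forall_root_near exists_root_unique_near)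
open Summit.HodgeConjecture.HodgeConjecture.Cruxes.H413.F0P3cStCharTSRootPersist (exists_root_near_of_simple_root)

namespace Summit.HodgeConjecture.HodgeConjecture.Cruxes.H413.F0P3cStCharTSRootCount

/-! ## §1 Combinatorics of a two-sided unique correspondence; a positive lower bound for finitely many positive reals -/

/-- **Counting across a correspondence.**  If every `r ∈ S` is related to EXACTLY ONE `a ∈ T` and every `a ∈ T` to EXACTLY ONE `r ∈ S`, and the
predicates `P` on `S`, `Q` on `T` agree across related pairs, then `#(S.filter P) = #(T.filter Q)` (the correspondence restricts to a bijection). [folklore] -/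
theorem card_filter_eq_of_correspondence {α β : Type*} (R : α → β → Prop) {S : Finset α} {T : Finset β}
    (h1 : ∀ r ∈ S, ∃! a, a ∈ T ∧ R r a) (h2 : ∀ a ∈ T, ∃! r, r ∈ S ∧ R r a)
    (P : α → Prop) (Q : β → Prop) [DecidablePred P] [DecidablePred Q] (hPQ : ∀ r ∈ S, ∀ a ∈ T, R r a → (P r ↔ Q a)) :
    (S.filter P).card = (T.filter Q).card := by
  classical
  -- the map `i : S.filter P → T.filter Q`, `r ↦` the unique related `a`
  have hex : ∀ r ∈ S.filter P, ∃ a, a ∈ T.filter Q ∧ R r a := by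
    intro r hr
    rw [Finset.mem_filter] at hr
    obtain ⟨a, ⟨haT, hRa⟩, -⟩ := h1 r hr.1
    exact ⟨a, Finset.mem_filter.2 ⟨haT, (hPQ r hr.1 a haT hRa).1 hr.2⟩, hRa⟩
  choose i hi hRi using hex
  refine Finset.card_bij i hi ?_ ?_
  · -- injective: two elements related to the same `a` coincide by uniqueness at `a`
    intro r₁ hr₁ r₂ hr₂ heq
    have hr₁S : r₁ ∈ S := (Finset.mem_filter.1 hr₁).1
    have hr₂S : r₂ ∈ S := (Finset.mem_filter.1 hr₂).1
    have haT : i r₁ hr₁ ∈ T := (Finset.mem_filter.1 (hi r₁ hr₁)).1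
    obtain ⟨r, -, huniq⟩ := h2 (i r₁ hr₁) haT
    have e₁ : r₁ = r := huniq r₁ ⟨hr₁S, hRi r₁ hr₁⟩
    have e₂ : r₂ = r := huniq r₂ ⟨hr₂S, by rw [heq]; exact hRi r₂ hr₂⟩
    rw [e₁, e₂]
  · -- surjective: `a ∈ T.filter Q` is hit by its unique related `r`
    intro a ha
    rw [Finset.mem_filter] at ha
    obtain ⟨r, ⟨hrS, hRa⟩, -⟩ := h2 a ha.1
    have hrP : P r := (hPQ r hrS a ha.1 hRa).2 ha.2
    have hr : r ∈ S.filter P := Finset.mem_filter.2 ⟨hrS, hrP⟩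
    refine ⟨r, hr, ?_⟩
    -- `i r` and `a` are both related to `r` inside `T`: uniqueness at `r`
    obtain ⟨a', -, huniq⟩ := h1 r hrS
    have e₁ : i r hr = a' := huniq (i r hr) ⟨(Finset.mem_filter.1 (hi r hr)).1, hRi r hr⟩
    have e₂ : a = a' := huniq a ⟨ha.1, hRa⟩
    rw [e₁, e₂]

/-- **Counting across a correspondence (no predicate).** `#S = #T`. [folklore] -/
theorem card_eq_of_correspondence {α β : Type*} (R : α → β → Prop) {S : Finset α} {T : Finset β}
    (h1 : ∀ r ∈ S, ∃! a, a ∈ T ∧ R r a) (h2 : ∀ a ∈ T, ∃! r, r ∈ S ∧ R r a) : S.card = T.card := by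
  classical
  have h := card_filter_eq_of_correspondence R h1 h2 (fun _ => True) (fun _ => True) (fun _ _ _ _ _ => Iff.rfl)
  rwa [Finset.filter_true_of_mem (fun _ _ => trivial), Finset.filter_true_of_mem (fun _ _ => trivial)] at h

/-- A positive lower bound for finitely many positive reals. [folklore] -/
theorem exists_pos_le_of_finset {ι : Type*} (S : Finset ι) (f : ι → ℝ) (hf : ∀ a ∈ S, 0 < f a) :
    ∃ m : ℝ, 0 < m ∧ ∀ a ∈ S, m ≤ f a := by
  rcases S.eq_empty_or_nonempty with h | hne
  · exact ⟨1, one_pos, fun a ha => by rw [h] at ha; exact absurd ha (Finset.notMem_empty a)⟩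
  · obtain ⟨a, ha, hmin⟩ := S.exists_min_image f hne
    exact ⟨f a, hf a ha, fun b hb => hmin b hb⟩

/-! ## §2 The window correspondence of roots (proper normed field) -/

variable {K : Type*} [NormedField K] [ProperSpace K]

omit [ProperSpace K] in
/-- Distinct points of a finset are uniformly separated: `∃ δ > 0`, `a ≠ b ⇒ 2δ ≤ ‖a − b‖`. [folklore] -/
theorem exists_pos_separating (S : Finset K) : ∃ δ : ℝ, 0 < δ ∧ ∀ a ∈ S, ∀ b ∈ S, a ≠ b → 2 * δ ≤ ‖a - b‖ := by
  classical
  obtain ⟨m, hm, hle⟩ := exists_pos_le_of_finset (S ×ˢ S) (fun z : K × K => if z.1 = z.2 then 1 else ‖z.1 - z.2‖ / 2)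
    (fun z _ => by
      split_ifs with h
      · exact one_pos
      · exact half_pos (norm_pos_iff.2 (sub_ne_zero.2 h)))
  refine ⟨m, hm, fun a ha b hb hab => ?_⟩
  have h := hle (a, b) (Finset.mem_product.2 ⟨ha, hb⟩)
  dsimp only at h
  rw [if_neg hab] at h
  linarith

/-- **The window correspondence of roots.**  `K` a proper normed field, `p₀ ∈ K[X]` monic with every `K`-root simple.  There are `δ > 0`, separating the
roots of `p₀` (`a ≠ b ⇒ 2δ ≤ ‖a − b‖`), and `ρ > 0` such that for every monic `p` of the same degree with `‖p_i − p₀,i‖ < ρ` for all `i`: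
(i) every `K`-root of `p` lies within `δ` of EXACTLY ONE root of `p₀`; (ii) every root of `p₀` has EXACTLY ONE `K`-root of `p` within `δ`. [folklore] -/
theorem exists_window_roots_correspondence {p₀ : K[X]} (hp₀ : p₀.Monic) (hsimple : ∀ a ∈ p₀.roots, (derivative p₀).eval a ≠ 0) :
    ∃ δ ρ : ℝ, 0 < δ ∧ 0 < ρ ∧ (∀ a ∈ p₀.roots, ∀ b ∈ p₀.roots, a ≠ b → 2 * δ ≤ ‖a - b‖) ∧
      ∀ p : K[X], p.Monic → p.natDegree = p₀.natDegree → (∀ i, ‖p.coeff i - p₀.coeff i‖ < ρ) →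
        (∀ r ∈ p.roots, ∃! a, a ∈ p₀.roots ∧ ‖r - a‖ < δ) ∧
        (∀ a ∈ p₀.roots, ∃! r, r ∈ p.roots ∧ ‖r - a‖ < δ) := by
  classical
  set S := p₀.roots.toFinset with hS
  have hmemS : ∀ a, a ∈ S ↔ a ∈ p₀.roots := fun a => Multiset.mem_toFinset
  set N := p₀.natDegree + 1 with hN
  have h₀ : p₀.natDegree < N := Nat.lt_succ_self _
  -- (1) separation `δ₁` of the old roots; (2) uniqueness radii `ρu a` (★ `exists_root_unique_near`), uniform lower bound `δ₂`
  obtain ⟨δ₁, hδ₁, hsep⟩ := exists_pos_separating S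
  have hu : ∀ a : K, ∃ ρ : ℝ, 0 < ρ ∧ (a ∈ p₀.roots → ∀ p : K[X], p.natDegree < N → (∀ i, ‖p.coeff i - p₀.coeff i‖ < ρ) →
      ∀ r₁ r₂ : K, p.IsRoot r₁ → p.IsRoot r₂ → ‖r₁ - a‖ < ρ → ‖r₂ - a‖ < ρ → r₁ = r₂) := by
    intro a
    by_cases ha : a ∈ p₀.roots
    · obtain ⟨ρ, hρ, h⟩ := exists_root_unique_near h₀ (hsimple a ha)
      exact ⟨ρ, hρ, fun _ => h⟩
    · exact ⟨1, one_pos, fun h => absurd h ha⟩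
  choose ρu hρu huniq using hu
  obtain ⟨δ₂, hδ₂, hδ₂le⟩ := exists_pos_le_of_finset S ρu fun a _ => hρu a
  set δ : ℝ := min δ₁ δ₂ with hδ
  have hδpos : 0 < δ := lt_min hδ₁ hδ₂
  -- (3) existence radii `ρe a` for the window `δ` (★ P1), uniform lower bound `ρ₃`; (4) «no new roots» radius `ε` (★ `exists_forall_root_near`)
  have he : ∀ a : K, ∃ ρ : ℝ, 0 < ρ ∧ (a ∈ p₀.roots → ∀ p : K[X], p.natDegree < N → (∀ i, ‖p.coeff i - p₀.coeff i‖ < ρ) →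
      ∃ r : K, p.IsRoot r ∧ ‖r - a‖ < δ) := by
    intro a
    by_cases ha : a ∈ p₀.roots
    · obtain ⟨ρ, hρ, h⟩ := exists_root_near_of_simple_root h₀ ((mem_roots hp₀.ne_zero).1 ha) (hsimple a ha) hδpos
      exact ⟨ρ, hρ, fun _ => h⟩
    · exact ⟨1, one_pos, fun h => absurd h ha⟩
  choose ρe hρe hex using he
  obtain ⟨ρ₃, hρ₃, hρ₃le⟩ := exists_pos_le_of_finset S ρe fun a _ => hρe a
  obtain ⟨ε, hε, hold⟩ := exists_forall_root_near p₀ hp₀ hδpos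
  set ρ : ℝ := min (min δ₂ ρ₃) ε with hρ
  have hρpos : 0 < ρ := lt_min (lt_min hδ₂ hρ₃) hε
  have hρδ₂ : ρ ≤ δ₂ := le_trans (min_le_left _ _) (min_le_left _ _)
  have hρρ₃ : ρ ≤ ρ₃ := le_trans (min_le_left _ _) (min_le_right _ _)
  have hρε : ρ ≤ ε := min_le_right _ _
  refine ⟨δ, ρ, hδpos, hρpos, fun a ha b hb hab => ?_, fun p hp hdeg hcoeff => ?_⟩
  · exact le_trans (by linarith [min_le_left δ₁ δ₂]) (hsep a ((hmemS a).2 ha) b ((hmemS b).2 hb) hab)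
  have hpN : p.natDegree < N := by rw [hdeg]; exact h₀
  have hp0 : p ≠ 0 := hp.ne_zero
  -- uniqueness at an old root `a` inside the window `δ ≤ δ₂ ≤ ρu a`
  have huniq' : ∀ a ∈ p₀.roots, ∀ r₁ r₂ : K, r₁ ∈ p.roots → r₂ ∈ p.roots → ‖r₁ - a‖ < δ → ‖r₂ - a‖ < δ → r₁ = r₂ := by
    intro a ha r₁ r₂ h₁ h₂ hd₁ hd₂
    have hδa : δ ≤ ρu a := le_trans (min_le_right _ _) (hδ₂le a ((hmemS a).2 ha))
    exact huniq a ha p hpN (fun i => lt_of_lt_of_le (hcoeff i) (le_trans hρδ₂ (hδ₂le a ((hmemS a).2 ha))))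
      r₁ r₂ ((mem_roots hp0).1 h₁) ((mem_roots hp0).1 h₂) (lt_of_lt_of_le hd₁ hδa) (lt_of_lt_of_le hd₂ hδa)
  refine ⟨fun r hr => ?_, fun a ha => ?_⟩
  · -- (i) a root `r` of `p` is within `δ` of some old root (no new roots), unique by separation
    obtain ⟨a, ha, hra⟩ := hold p hp hdeg (fun i => lt_of_lt_of_le (hcoeff i) hρε) r ((mem_roots hp0).1 hr)
    refine ⟨a, ⟨ha, hra⟩, fun b hb => ?_⟩
    by_contra hba
    have h2 := hsep b ((hmemS b).2 hb.1) a ((hmemS a).2 ha) hba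
    have h3 : ‖b - a‖ ≤ ‖r - b‖ + ‖r - a‖ := by
      calc ‖b - a‖ = ‖(r - a) - (r - b)‖ := by congr 1; ring
        _ ≤ ‖r - a‖ + ‖r - b‖ := norm_sub_le _ _
        _ = ‖r - b‖ + ‖r - a‖ := add_comm _ _
    have h4 : δ ≤ δ₁ := min_le_left _ _
    linarith [hb.2]
  · -- (ii) an old root `a` has a root of `p` within `δ` (★ P1), unique (★ uniqueness radius)
    obtain ⟨r, hr, hra⟩ := hex a ha p hpN (fun i => lt_of_lt_of_le (hcoeff i) (le_trans hρρ₃ (hρ₃le a ((hmemS a).2 ha))))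
    exact ⟨r, ⟨(mem_roots hp0).2 hr, hra⟩, fun r' hr' => huniq' a ha r' r hr'.1 ((mem_roots hp0).2 hr) hr'.2 hra⟩

/-! ## §3 The number of rational roots (with a window-stable property) is locally constant -/

/-- **Root count is locally constant.**  `K` proper, `p₀` monic with every `K`-root simple: for some `ρ > 0` every monic `p` of the same degree with
coefficients within `ρ` has the same number of DISTINCT `K`-roots, `#(p.roots.toFinset) = #(p₀.roots.toFinset)`. [folklore] -/
theorem card_roots_toFinset_eq_of_near [DecidableEq K] {p₀ : K[X]} (hp₀ : p₀.Monic)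
    (hsimple : ∀ a ∈ p₀.roots, (derivative p₀).eval a ≠ 0) :
    ∃ ρ : ℝ, 0 < ρ ∧ ∀ p : K[X], p.Monic → p.natDegree = p₀.natDegree → (∀ i, ‖p.coeff i - p₀.coeff i‖ < ρ) →
      p.roots.toFinset.card = p₀.roots.toFinset.card := by
  obtain ⟨δ, ρ, -, hρ, -, hcorr⟩ := exists_window_roots_correspondence hp₀ hsimple
  refine ⟨ρ, hρ, fun p hp hdeg hcoeff => ?_⟩
  obtain ⟨h1, h2⟩ := hcorr p hp hdeg hcoeff
  refine card_eq_of_correspondence (fun r a => ‖r - a‖ < δ) (fun r hr => ?_) (fun a ha => ?_)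
  · simpa only [Multiset.mem_toFinset] using h1 r (Multiset.mem_toFinset.1 hr)
  · simpa only [Multiset.mem_toFinset] using h2 a (Multiset.mem_toFinset.1 ha)

/-- **Root count with a window-stable property is locally constant.**  Same setting; there are `δ > 0` (separating the roots of `p₀`) and `ρ > 0` such
that for every monic `p` of the same degree with coefficients within `ρ` and every predicate `P` that agrees across the window (`r ∈ p.roots`,
`a ∈ p₀.roots`, `‖r − a‖ < δ ⇒ (P r ↔ P a)`): `#{r ∈ p.roots | P r} = #{a ∈ p₀.roots | P a}`.  (S13b: `P u := σ u · u = 1`, the norm-one roots.) [folklore] -/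
theorem card_filter_roots_eq_of_near [DecidableEq K] {p₀ : K[X]} (hp₀ : p₀.Monic)
    (hsimple : ∀ a ∈ p₀.roots, (derivative p₀).eval a ≠ 0) :
    ∃ δ ρ : ℝ, 0 < δ ∧ 0 < ρ ∧ (∀ a ∈ p₀.roots, ∀ b ∈ p₀.roots, a ≠ b → 2 * δ ≤ ‖a - b‖) ∧
      ∀ p : K[X], p.Monic → p.natDegree = p₀.natDegree → (∀ i, ‖p.coeff i - p₀.coeff i‖ < ρ) →
        ∀ (P : K → Prop) [DecidablePred P], (∀ r ∈ p.roots, ∀ a ∈ p₀.roots, ‖r - a‖ < δ → (P r ↔ P a)) →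
          (p.roots.toFinset.filter P).card = (p₀.roots.toFinset.filter P).card := by
  obtain ⟨δ, ρ, hδ, hρ, hsep, hcorr⟩ := exists_window_roots_correspondence hp₀ hsimple
  refine ⟨δ, ρ, hδ, hρ, hsep, fun p hp hdeg hcoeff P _ hP => ?_⟩
  obtain ⟨h1, h2⟩ := hcorr p hp hdeg hcoeff
  refine card_filter_eq_of_correspondence (fun r a => ‖r - a‖ < δ) (fun r hr => ?_) (fun a ha => ?_) P P (fun r hr a ha h => ?_)
  · simpa only [Multiset.mem_toFinset] using h1 r (Multiset.mem_toFinset.1 hr)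
  · simpa only [Multiset.mem_toFinset] using h2 a (Multiset.mem_toFinset.1 ha)
  · exact hP r (Multiset.mem_toFinset.1 hr) a (Multiset.mem_toFinset.1 ha) h

omit [ProperSpace K] in
/-- The simplicity hypothesis from separability (★ `isUnit_aeval_derivative_of_separable`). [folklore] -/
theorem eval_derivative_ne_zero_of_separable {p₀ : K[X]} (hsep : p₀.Separable) :
    ∀ a ∈ p₀.roots, (derivative p₀).eval a ≠ 0 := by
  intro a ha
  have hp0 : p₀ ≠ 0 := hsep.ne_zero
  have hroot : aeval a p₀ = 0 := by rw [coe_aeval_eq_eval]; exact ((mem_roots hp0).1 ha).eq_zero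
  have h := Literature.LinearAlgebra.Matrix.isUnit_aeval_derivative_of_separable hsep hroot
  rw [coe_aeval_eq_eval] at h
  exact h.ne_zero

/-- **Root count is locally constant — separable dress.** [folklore] -/
theorem card_roots_toFinset_eq_of_near_of_separable [DecidableEq K] {p₀ : K[X]} (hp₀ : p₀.Monic) (hsep : p₀.Separable) :
    ∃ ρ : ℝ, 0 < ρ ∧ ∀ p : K[X], p.Monic → p.natDegree = p₀.natDegree → (∀ i, ‖p.coeff i - p₀.coeff i‖ < ρ) →
      p.roots.toFinset.card = p₀.roots.toFinset.card :=
  card_roots_toFinset_eq_of_near hp₀ (eval_derivative_ne_zero_of_separable hsep)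

end Summit.HodgeConjecture.HodgeConjecture.Cruxes.H413.F0P3cStCharTSRootCount

end
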